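import Literature.NumberTheory.EllipticCurves.KubertTate172SqrtNegTwoDescent
import Literature.NumberTheory.EllipticCurves.KubertTate1718SqrtNegTwoTwist
import HarnessLib

/-!
# The quadratic twist `W₂ = E_{17/2}^{(−8)} = [0, −178, 0, 32640, −591872]`: RANK `1`, `t₅ = 0`, `corank Sel₅∞ = 1`, globally minimal,
# `W₂[5]` reducible — the hypotheses of the printed Eisenstein `5`-converse (CGLS Thm. E, `r = 1`) on a curve WITHOUT rational `5`-torsion

PROOF-ONLY file (theorems only, no definition, no named fact, no `sorry`), topic `NumberTheory/EllipticCurves`; the RANK-ONE row of the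
`ℚ(√−2)` twist door (class-wide splitting `KubertTateSqrtNegTwoTwist.*` of `KubertTate1718SqrtNegTwoTwist`; descent
`KubertTate172SqrtNegTwoDescent`: `rank E_{17/2}(K) = 2`, `t₅(E ⊗ K) = 0`; `ℚ`-side `KubertTate172ShaFive`: rank `1`, `t₅ = 0`):

* §2 `twist_eq` (`E_{17/2}^{(−8)} = [0, −178, 0, 32640, −591872]`), **`mordellWeilRank_twist_eq_one`** (`2 − 1 = 1`), **`shaCorank_five_twist_eq_zero`**,
  `twist_17_2`, `rank_one_door_at_five_model`;
* §3 **`isGloballyMinimal_model`** (`Δ = −2²³·17⁵·89`, Kraus at `2`: `v₂(Δ) = 23`, `v₂(c₄) = 6`, `v₂(c₆ + 2⁶) = 6`), `red_five_model` (`W₂[5]` reducible),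
  `door_model_cast` (rank `1`, `t₅ = 0` on the cast model), **`selmerCorank_five_model`** (`corank_{ℤ₅} Sel_{5^∞}(W₂/ℚ) = 1`).

Why (stmt-BirchSwinnertonDyer-22356, «T»): with `a₅(W₂) = −1` (Summits sequel: `#W̃₂(𝔽₅) = 7`) the pair `(W₂, 5)` satisfies EVERY hypothesis of
Castella–Grossi–Lee–Skinner 2022 Thm. E at `r = 1` (`5 > 2`, good, reducible, non-anomalous, corank `1`) — so `ord_{s=1} L(W₂, s) = 1` and `Ш(W₂/ℚ)`
finite follow from REFEREED PRINT (CGLS + GZK), i.e. T is DISCHARGED at this curve modulo print: the first such row over `ℚ(√−2)`.  T itself and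
BSD are NOT proved by this.

## References

* [SilvermanAEC2009] J. H. Silverman, *AEC*, 2nd ed., Thm. X.4.2, Exercise 10.16, X.§2, VII.1 Remark 1.1.
* [Kraus1989] A. Kraus, *Quelques remarques à propos des invariants c₄, c₆ et Δ d'une courbe elliptique*, Acta Arith. 54 (1989), Prop. 2.
* [CastellaGrossiLeeSkinner2022] F. Castella, G. Grossi, J. Lee, C. Skinner, Invent. Math. 227 (2022), Thm. E.
* [Marcus2018] D. A. Marcus, *Number Fields*, 2nd ed., Ch. 2 Thm. 1.
-/

noncomputable section

open scoped Classical
open WeierstrassCurve Literature.NumberTheory.EllipticCurves Literature.NumberTheory.EllipticCurves.KubertTateVelu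
  Literature.NumberTheory.EllipticCurves.KubertTateGaussianTwist Literature.NumberTheory.QuadraticFields
  Literature.NumberTheory.EllipticCurves.KubertTateSqrtNegTwoTwist
open Literature.NumberTheory.EllipticCurves.Rank1Residual.X11RankOneCertificates (discOf c4Of c6Of)

namespace Literature.NumberTheory.EllipticCurves

namespace KubertTate172SqrtNegTwoTwist

/-- Transport of the Mordell–Weil rank along an equality of curves. [folklore] -/
private theorem mordellWeilRank_congr {F : Type} [Field F] [NumberField F] {V V' : WeierstrassCurve F}
    [V.IsElliptic] [V'.IsElliptic] (e : V = V') : V.mordellWeilRank = V'.mordellWeilRank := by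
  subst e; rfl

/-- Transport of `t_p` along an equality of curves. [folklore] -/
private theorem shaCorank_congr {F : Type} [Field F] [NumberField F] {V V' : WeierstrassCurve F}
    [V.IsElliptic] [V'.IsElliptic] (e : V = V') (p : ℕ) [Fact p.Prime] : V.shaCorank p = V'.shaCorank p := by
  subst e; rfl

/-! ## §2 The instance `E_{17/2}^{(−8)}`: rank `2` and `t₅ = 0` from the descent over `ℚ(√−2)` -/

/-- **`E_{17/2}^{(−8)} = [0, −178, 0, 32640, −591872]`** (`b₂ = 89`, `b₄ = 1020`, `b₆ = 4624`; twist by `d = −8`).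
[cite: SilvermanAEC2009, X.§2] -/
theorem twist_eq : (kubertTateFive (((17 : ℤ) : ℚ)) (((2 : ℤ) : ℚ))).quadraticTwist (-8) =
    (⟨0, -178, 0, 32640, -591872⟩ : WeierstrassCurve ℚ) := by
  rw [KubertTate172Descent.curve_eq]
  ext <;> simp [quadraticTwist, WeierstrassCurve.b₂, WeierstrassCurve.b₄, WeierstrassCurve.b₆] <;> norm_num

/-- The twist by `−8` is elliptic. [cite: SilvermanAEC2009, X.§2] -/
theorem isElliptic_twist :
    haveI := KubertTate172Descent.isElliptic
    ((kubertTateFive (((17 : ℤ) : ℚ)) (((2 : ℤ) : ℚ))).quadraticTwist (-8)).IsElliptic := by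
  haveI := KubertTate172Descent.isElliptic
  exact isElliptic_quadraticTwist _ (by norm_num)

/-- **`rank E_{17/2}^{(−8)}(ℚ) = 1`, unconditionally**: `rank E(K) = rank E(ℚ) + rank E^{(−8)}(ℚ)` at `K = ℚ(√−2)` with `2 = 1 + rank E^{(−8)}(ℚ)`
(`KubertTate172SqrtNegTwoDescent.mordellWeilRank_eq_two`, `KubertTate172Descent.mordellWeilRank_eq`). [cite: SilvermanAEC2009, Exercise 10.16] -/
theorem mordellWeilRank_twist_eq_one :
    haveI := KubertTate172Descent.isElliptic
    haveI := isElliptic_twist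
    ((kubertTateFive (((17 : ℤ) : ℚ)) (((2 : ℤ) : ℚ))).quadraticTwist (-8)).mordellWeilRank = 1 := by
  haveI := KubertTate172Descent.isElliptic
  haveI := isElliptic_twist
  obtain ⟨K, _, _, θ, hK⟩ := exists_sqrtNegTwo_field
  have hR := mordellWeilRank_base_eq_add_sqrtNegTwo (K := K) 17 2 hK
  have h4 := KubertTate172SqrtNegTwoDescent.mordellWeilRank_eq_two hK
  have h2 := KubertTate172Descent.mordellWeilRank_eq
  simp only [Int.cast_ofNat] at hR h4 h2 ⊢
  omega

/-- **`t₅(E_{17/2}^{(−8)}/ℚ) = 0`, unconditionally** — the door at `5` on a RANK-`1` twist WITHOUT a rational `5`-torsion point, at a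
NON-anomalous good ordinary prime (`5` inert in `ℚ(√−2)`), by descent alone (`t₅(E ⊗ ℚ(√−2)) = 0`,
`KubertTate172SqrtNegTwoDescent.shaCorank_five_eq_zero`). [cite: Dokchitser2013ParityNotes, §4] [cite: SilvermanAEC2009, Thm. X.4.2] -/
theorem shaCorank_five_twist_eq_zero :
    haveI := KubertTate172Descent.isElliptic
    haveI := isElliptic_twist
    ((kubertTateFive (((17 : ℤ) : ℚ)) (((2 : ℤ) : ℚ))).quadraticTwist (-8)).shaCorank 5 = 0 := by
  haveI := KubertTate172Descent.isElliptic
  haveI := isElliptic_twist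
  obtain ⟨K, _, _, θ, hK⟩ := exists_sqrtNegTwo_field
  have h := shaCorank_twist_eq_zero_of_base_sqrtNegTwo (K := K) 17 2 hK
    (by simpa using KubertTate172SqrtNegTwoDescent.shaCorank_five_eq_zero hK)
  simpa using h.1

/-- **Both components at once**: `rank E_{17/2}^{(−8)}(ℚ) = 1`, `t₅(E_{17/2}^{(−8)}/ℚ) = 0`, together with `rank E_{17/2}(ℚ) = 1`,
`t₅(E_{17/2}/ℚ) = 0` (tree) — the cross-field picture `rank E(ℚ(√−2)) = 1 + 1`, `t₅(E ⊗ ℚ(√−2)) = 0 + 0`.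
[cite: SilvermanAEC2009, Thm. X.4.2 and Exercise 10.16] -/
theorem twist_17_2 :
    haveI := KubertTate172Descent.isElliptic
    haveI := isElliptic_twist
    ((kubertTateFive (((17 : ℤ) : ℚ)) (((2 : ℤ) : ℚ))).quadraticTwist (-8)).mordellWeilRank = 1 ∧
      ((kubertTateFive (((17 : ℤ) : ℚ)) (((2 : ℤ) : ℚ))).quadraticTwist (-8)).shaCorank 5 = 0 ∧
      (kubertTateFive (((17 : ℤ) : ℚ)) (((2 : ℤ) : ℚ))).mordellWeilRank = 1 ∧
      (kubertTateFive (((17 : ℤ) : ℚ)) (((2 : ℤ) : ℚ))).shaCorank 5 = 0 :=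
  ⟨mordellWeilRank_twist_eq_one, shaCorank_five_twist_eq_zero, KubertTate172Descent.mordellWeilRank_eq,
    KubertTate172Descent.shaCorank_five_eq_zero⟩

/-- **The twist as the explicit curve `[0, −178, 0, 32640, −591872]`: rank `1` and `t₅ = 0`.** [cite: SilvermanAEC2009, Thm. X.4.2] -/
theorem rank_one_door_at_five_model :
    haveI : (⟨0, -178, 0, 32640, -591872⟩ : WeierstrassCurve ℚ).IsElliptic := by
      haveI := KubertTate172Descent.isElliptic; rw [← twist_eq]; exact isElliptic_twist
    (⟨0, -178, 0, 32640, -591872⟩ : WeierstrassCurve ℚ).mordellWeilRank = 1 ∧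
      (⟨0, -178, 0, 32640, -591872⟩ : WeierstrassCurve ℚ).shaCorank 5 = 0 := by
  haveI := KubertTate172Descent.isElliptic
  haveI := isElliptic_twist
  haveI : (⟨0, -178, 0, 32640, -591872⟩ : WeierstrassCurve ℚ).IsElliptic := by
    rw [← twist_eq]; exact isElliptic_twist
  haveI : Fact (Nat.Prime 5) := ⟨Nat.prime_five⟩
  exact ⟨by rw [← mordellWeilRank_congr twist_eq]; exact mordellWeilRank_twist_eq_one,
    by rw [← shaCorank_congr twist_eq 5]; exact shaCorank_five_twist_eq_zero⟩

/-! ## §3 The model `W₂ = [0, −178, 0, 32640, −591872]`: globally minimal, `W₂[5]` reducible -/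

/-- The integer-cast form of the model equals the rational-numeral form. [folklore] -/
private theorem model_cast_eq :
    (⟨((0 : ℤ) : ℚ), ((-178 : ℤ) : ℚ), ((0 : ℤ) : ℚ), ((32640 : ℤ) : ℚ), ((-591872 : ℤ) : ℚ)⟩ : WeierstrassCurve ℚ) =
      ⟨0, -178, 0, 32640, -591872⟩ := by
  ext <;> norm_num

/-- The cast model is elliptic. [cite: SilvermanAEC2009, X.§2] -/
theorem isElliptic_model :
    (⟨((0 : ℤ) : ℚ), ((-178 : ℤ) : ℚ), ((0 : ℤ) : ℚ), ((32640 : ℤ) : ℚ), ((-591872 : ℤ) : ℚ)⟩ : WeierstrassCurve ℚ).IsElliptic := by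
  haveI := KubertTate172Descent.isElliptic
  rw [model_cast_eq, ← twist_eq]; exact isElliptic_twist

/-- `Δ`, `c₄`, `c₆` of the integer model (kernel evaluation): `Δ(W₂) = −1060045517225984 = −2²³·17⁵·89`,
`c₄ = −1059776 = −2⁶·16559`, `c₆ = −800935424 = −2⁹·1564327`. [folklore] -/
private theorem invariants_model :
    discOf [0, -178, 0, 32640, -591872] = -1060045517225984 ∧
      c4Of [0, -178, 0, 32640, -591872] = -1059776 ∧ c6Of [0, -178, 0, 32640, -591872] = -800935424 := by
  refine ⟨?_, ?_, ?_⟩ <;> decide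

/-- **`W₂` is globally minimal**: at `2` by Kraus (`v₂(Δ) = 23 < 24`, `v₂(c₄) = 6 < 8`, `v₂(c₆ + 2⁶) = 6 < 8`: additive reduction of the
`−8`-twist at `2`, the equation already minimal), and no odd prime divides `Δ(W₂) = −2²³·17⁵·89` to the twelfth power.
[cite: Kraus1989, Prop. 2] [cite: SilvermanAEC2009, VII.1 Remark 1.1] -/
theorem isGloballyMinimal_model :
    (⟨((0 : ℤ) : ℚ), ((-178 : ℤ) : ℚ), ((0 : ℤ) : ℚ), ((32640 : ℤ) : ℚ), ((-591872 : ℤ) : ℚ)⟩ : WeierstrassCurve ℚ).IsGloballyMinimal := by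
  obtain ⟨hD, hc4, hc6⟩ := invariants_model
  refine WeierstrassCurve.isGloballyMinimal_of_int_kraus 0 (-178) 0 32640 (-591872) fun q hq ↦ ?_
  by_cases hq2 : q = 2
  · subst hq2
    refine Or.inr (Or.inl ⟨rfl, ?_, ?_, ?_⟩)
    · rw [hD]; norm_num
    · rw [hc4]; norm_num
    · rw [hc6]; norm_num
  · refine Or.inl fun h ↦ ?_
    obtain ⟨h12, -⟩ := h
    rw [hD] at h12
    have hq1 : (q : ℤ) ∣ 1060045517225984 := Int.dvd_neg.mp (dvd_trans (dvd_pow_self _ (by norm_num)) h12)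
    have hdvdN : q ∣ 2 ^ 23 * 17 ^ 5 * 89 := by
      have e : ((2 ^ 23 * 17 ^ 5 * 89 : ℕ) : ℤ) = 1060045517225984 := by norm_num
      exact Int.natCast_dvd_natCast.mp (e ▸ hq1)
    have hpi := Nat.Prime.prime hq
    rcases hpi.dvd_or_dvd hdvdN with h | h
    · rcases hpi.dvd_or_dvd h with h | h
      · exact hq2 ((Nat.prime_dvd_prime_iff_eq hq Nat.prime_two).mp (hpi.dvd_of_dvd_pow h))
      · have := (Nat.prime_dvd_prime_iff_eq hq (by norm_num : Nat.Prime 17)).mp (hpi.dvd_of_dvd_pow h)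
        subst this; revert h12; norm_num
    · have := (Nat.prime_dvd_prime_iff_eq hq (by norm_num : Nat.Prime 89)).mp h
      subst this; revert h12; norm_num

/-- **`W₂[5]` is reducible** (quadratic twist of `E_{17/2}`, whose rational point `(0,0)` of order `5` spans a `Γ_ℚ`-stable line; tree
`Rank1Residual.not_hasIrreducibleModPGaloisRep_twist`). [cite: SilvermanAEC2009, X.5 Cor. 5.4] -/
theorem red_five_model :
    haveI := isElliptic_model
    haveI : Fact (Nat.Prime 5) := ⟨Nat.prime_five⟩
    ¬ (⟨((0 : ℤ) : ℚ), ((-178 : ℤ) : ℚ), ((0 : ℤ) : ℚ), ((32640 : ℤ) : ℚ), ((-591872 : ℤ) : ℚ)⟩ :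
        WeierstrassCurve ℚ).HasIrreducibleModPGaloisRep 5 := by
  haveI := KubertTate172Descent.isElliptic
  haveI := isElliptic_model
  haveI : Fact (Nat.Prime 5) := ⟨Nat.prime_five⟩
  exact Rank1Residual.not_hasIrreducibleModPGaloisRep_twist (KubertTateEisensteinTwist.red_five 17 2) (d := -8) (by norm_num)
    _ (1 : VariableChange ℚ) (by rw [one_smul, model_cast_eq, twist_eq])

/-- **`rank W₂(ℚ) = 1` and `t₅(W₂) = 0` on the cast model.** [cite: SilvermanAEC2009, Thm. X.4.2] -/
theorem door_model_cast :
    haveI := isElliptic_model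
    (⟨((0 : ℤ) : ℚ), ((-178 : ℤ) : ℚ), ((0 : ℤ) : ℚ), ((32640 : ℤ) : ℚ), ((-591872 : ℤ) : ℚ)⟩ : WeierstrassCurve ℚ).mordellWeilRank = 1 ∧
      (⟨((0 : ℤ) : ℚ), ((-178 : ℤ) : ℚ), ((0 : ℤ) : ℚ), ((32640 : ℤ) : ℚ), ((-591872 : ℤ) : ℚ)⟩ : WeierstrassCurve ℚ).shaCorank 5 = 0 := by
  haveI := KubertTate172Descent.isElliptic
  haveI := isElliptic_twist
  haveI := isElliptic_model
  haveI : Fact (Nat.Prime 5) := ⟨Nat.prime_five⟩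
  have e : (kubertTateFive (((17 : ℤ) : ℚ)) (((2 : ℤ) : ℚ))).quadraticTwist (-8) =
      ⟨((0 : ℤ) : ℚ), ((-178 : ℤ) : ℚ), ((0 : ℤ) : ℚ), ((32640 : ℤ) : ℚ), ((-591872 : ℤ) : ℚ)⟩ := by
    rw [twist_eq, model_cast_eq]
  exact ⟨by rw [← mordellWeilRank_congr e]; exact mordellWeilRank_twist_eq_one,
    by rw [← shaCorank_congr e 5]; exact shaCorank_five_twist_eq_zero⟩

/-- **`corank_{ℤ₅} Sel_{5^∞}(W₂/ℚ) = 1`** on the globally minimal model (Greenberg's identity with rank `1`, `t₅ = 0`): the Selmer hypothesis of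
CGLS Theorem E at `r = 1`. [cite: CastellaGrossiLeeSkinner2022, Thm. E (hypothesis corank = 1)] -/
theorem selmerCorank_five_model :
    haveI := isElliptic_model
    haveI : Fact (Nat.Prime 5) := ⟨Nat.prime_five⟩
    (⟨((0 : ℤ) : ℚ), ((-178 : ℤ) : ℚ), ((0 : ℤ) : ℚ), ((32640 : ℤ) : ℚ), ((-591872 : ℤ) : ℚ)⟩ : WeierstrassCurve ℚ).selmerCorank 5 = 1 := by
  haveI := isElliptic_model
  haveI : Fact (Nat.Prime 5) := ⟨Nat.prime_five⟩
  obtain ⟨hr, ht⟩ := door_model_cast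
  rw [(⟨((0 : ℤ) : ℚ), ((-178 : ℤ) : ℚ), ((0 : ℤ) : ℚ), ((32640 : ℤ) : ℚ), ((-591872 : ℤ) : ℚ)⟩ :
    WeierstrassCurve ℚ).selmerCorank_eq_mordellWeilRank_add_holds 5, hr, ht]

end KubertTate172SqrtNegTwoTwist

end Literature.NumberTheory.EllipticCurves

end
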